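import Literature.Analysis.FunctionSpaces.PoissonMappingHomeomorph
import Literature.Analysis.FunctionSpaces.PoissonPointProcessUniqueness
import Literature.Probability.Percolation.VoronoiCrossing
import Mathlib.MeasureTheory.Measure.Haar.InnerProductSpace
import Mathlib.MeasureTheory.Measure.Lebesgue.Complex
import HarnessLib

/-!
# Symmetries of two-colour Poisson–Voronoi percolation

Topic: Probability / Percolation.  Tassion 2016, Remark 2 (ii) "Invariance properties.  The
measure is invariant under translation, `π/2`-rotation and horizontal reflection", and the colour
symmetry at `p = 1/2`, for the tree's annealed model: two independent Poisson processes `PB`, `PW`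
of the same (Lebesgue) intensity on `ℂ`, configurations `PointConfig ℂ × PointConfig ℂ` under
`PB.prod PW`, colours read through `blackRegion`.

* `IsPoissonPointProcess.map_mapHomeomorph_eq` — a Poisson process is invariant in law under every
  homeomorphism preserving its (σ-finite) intensity (Mapping Theorem + Rényi uniqueness, both in
  the tree);
* `map_pairImage_eq`, `measure_preimage_pairImage` — hence `PB ⊗ PW` is invariant under moving
  both colours by such a homeomorphism, and every event (measurable or not) has the same
  probability as its preimage;
* `map_swap_eq`, `measure_preimage_swap` — colour swap: `PW = PB` (uniqueness), so `PB ⊗ PW` is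
  swap-invariant;
* `image_blackRegion`, `preimage_blackRegion` — isometries transport black regions;
* the volume-preserving homeomorphisms of `ℂ` used by RSW arguments: translations
  (`map_volume_addRight`) and real-linear isometries — rotations, reflections
  (`map_volume_linearIsometryEquiv`).

No definitions of events, no named facts.

## References
* V. Tassion, Ann. Probab. 44 (2016), Remark 2 and §4. [Tassion2016]
* J. F. C. Kingman, *Poisson Processes* (1993), §2.3 (Mapping Theorem). [Kingman1993]
-/

noncomputable section

namespace Literature.Probability.Percolation

open _root_.MeasureTheory _root_.Set _root_.Metric _root_.Function
open Literature.Analysis.FunctionSpaces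

/-! ### Invariance in law of a Poisson process -/

section Invariance

variable {E : Type*} [TopologicalSpace E] [MeasurableSpace E] [BorelSpace E]
  {ν ν' : Measure E} {P PB PW : Measure (PointConfig E)}

/-- **Invariance in law**: a Poisson process with σ-finite intensity `ν` has the same law as its
image under any homeomorphism `e` with `e_* ν = ν` (Mapping Theorem `mapHomeomorph'` and Rényi's
uniqueness `unique_holds`). [cite: Kingman1993, §2.3 Mapping Theorem] -/
theorem _root_.Literature.Analysis.FunctionSpaces.IsPoissonPointProcess.map_mapHomeomorph_eq
    [SigmaFinite ν] (hP : IsPoissonPointProcess ν P) (e : E ≃ₜ E) (he : ν.map e = ν) :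
    P.map (PointConfig.mapHomeomorph e) = P := by
  have h := hP.mapHomeomorph' e
  rw [he] at h
  exact (IsPoissonPointProcess.unique_holds hP h).symm

/-- Moving both colours by a homeomorphism. [folklore] -/
def pairImage (e : E ≃ₜ E) (ω : PointConfig E × PointConfig E) : PointConfig E × PointConfig E :=
  (ω.1.mapHomeomorph e, ω.2.mapHomeomorph e)

/-- `pairImage e` as a measurable equivalence. [folklore] -/
def pairImageEquiv (e : E ≃ₜ E) : (PointConfig E × PointConfig E) ≃ᵐ (PointConfig E × PointConfig E) :=
  (PointConfig.mapHomeomorphEquiv e).prodCongr (PointConfig.mapHomeomorphEquiv e)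

/-- The measurable equivalence is `pairImage`. [folklore] -/
@[simp] theorem coe_pairImageEquiv (e : E ≃ₜ E) : ⇑(pairImageEquiv e) = pairImage e := rfl

omit [MeasurableSpace E] [BorelSpace E] in
/-- The points of the moved configurations. [folklore] -/
@[simp] theorem coe_pairImage_fst (e : E ≃ₜ E) (ω : PointConfig E × PointConfig E) :
    (((pairImage e ω).1 : PointConfig E) : Set E) = e '' (ω.1 : Set E) := rfl

omit [MeasurableSpace E] [BorelSpace E] in
/-- The points of the moved configurations. [folklore] -/
@[simp] theorem coe_pairImage_snd (e : E ≃ₜ E) (ω : PointConfig E × PointConfig E) :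
    (((pairImage e ω).2 : PointConfig E) : Set E) = e '' (ω.2 : Set E) := rfl

/-- **`PB ⊗ PW` is invariant under moving both colours by an intensity-preserving
homeomorphism** (Tassion 2016, Remark 2 (ii)). [cite: Tassion2016, Remark 2] -/
theorem map_pairImage_eq [SigmaFinite ν] [SigmaFinite ν'] (hB : IsPoissonPointProcess ν PB)
    (hW : IsPoissonPointProcess ν' PW) (e : E ≃ₜ E) (heB : ν.map e = ν) (heW : ν'.map e = ν') :
    (PB.prod PW).map (pairImage e) = PB.prod PW := by
  haveI := hB.isProbabilityMeasure; haveI := hW.isProbabilityMeasure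
  rw [show pairImage e = Prod.map (PointConfig.mapHomeomorph e) (PointConfig.mapHomeomorph e) from rfl,
    ← Measure.map_prod_map _ _ (PointConfig.measurable_mapHomeomorph e)
      (PointConfig.measurable_mapHomeomorph e),
    hB.map_mapHomeomorph_eq e heB, hW.map_mapHomeomorph_eq e heW]

/-- Every event has the same probability as its preimage under `pairImage e` (no measurability
needed: `pairImage e` is a measurable equivalence). [cite: Tassion2016, Remark 2] -/
theorem measure_preimage_pairImage [SigmaFinite ν] [SigmaFinite ν'] (hB : IsPoissonPointProcess ν PB)
    (hW : IsPoissonPointProcess ν' PW) (e : E ≃ₜ E) (heB : ν.map e = ν) (heW : ν'.map e = ν')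
    (A : Set (PointConfig E × PointConfig E)) :
    (PB.prod PW) (pairImage e ⁻¹' A) = (PB.prod PW) A := by
  rw [← coe_pairImageEquiv, ← MeasurableEquiv.map_apply, coe_pairImageEquiv,
    map_pairImage_eq hB hW e heB heW]

omit [BorelSpace E] in
/-- **Colour symmetry**: two Poisson processes with the same σ-finite intensity have the same law,
so `PB ⊗ PW` is invariant under swapping the colours. [cite: Tassion2016, §4] -/
theorem map_swap_eq [SigmaFinite ν] (hB : IsPoissonPointProcess ν PB) (hW : IsPoissonPointProcess ν PW) :
    (PB.prod PW).map Prod.swap = PB.prod PW := by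
  haveI := hB.isProbabilityMeasure; haveI := hW.isProbabilityMeasure
  rw [Measure.prod_swap, IsPoissonPointProcess.unique_holds hW hB]

omit [BorelSpace E] in
/-- Every event has the same probability as its colour-swapped version. [cite: Tassion2016, §4] -/
theorem measure_preimage_swap [SigmaFinite ν] (hB : IsPoissonPointProcess ν PB)
    (hW : IsPoissonPointProcess ν PW) (A : Set (PointConfig E × PointConfig E)) :
    (PB.prod PW) (Prod.swap ⁻¹' A) = (PB.prod PW) A := by
  have h : ⇑(MeasurableEquiv.prodComm : (PointConfig E × PointConfig E) ≃ᵐ (PointConfig E × PointConfig E))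
      = Prod.swap := rfl
  rw [← h, ← MeasurableEquiv.map_apply, h, map_swap_eq hB hW]

end Invariance

/-! ### Isometries transport black regions -/

section Geometry

/-- An isometry onto maps the black region of `(B, W)` onto that of `(e B, e W)`. [folklore] -/
theorem image_blackRegion {e : ℂ → ℂ} (he : Isometry e) (hs : Surjective e) (B W : Set ℂ) :
    e '' blackRegion B W = blackRegion (e '' B) (e '' W) := by
  ext z
  obtain ⟨x, rfl⟩ := hs z
  rw [he.injective.mem_set_image, mem_blackRegion, mem_blackRegion, Metric.infDist_image he, Metric.infDist_image he]

/-- Preimage form: `x` is black for `(e⁻¹ B, e⁻¹ W)` iff `e x` is black for `(B, W)`, for a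
bijective isometry `e`. [folklore] -/
theorem mem_blackRegion_image_iff {e : ℂ → ℂ} (he : Isometry e) (B W : Set ℂ) (x : ℂ) :
    e x ∈ blackRegion (e '' B) (e '' W) ↔ x ∈ blackRegion B W := by
  rw [mem_blackRegion, mem_blackRegion, Metric.infDist_image he, Metric.infDist_image he]

end Geometry

/-! ### Volume-preserving homeomorphisms of the plane -/

section Plane

/-- Translations preserve Lebesgue measure on `ℂ`. [folklore] -/
theorem map_volume_addRight (v : ℂ) :
    (volume : Measure ℂ).map (Homeomorph.addRight v) = volume := by
  simpa using map_add_right_eq_self (volume : Measure ℂ) v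

/-- Real-linear isometries (rotations, reflections) preserve Lebesgue measure on `ℂ`. [folklore] -/
theorem map_volume_linearIsometryEquiv (f : ℂ ≃ₗᵢ[ℝ] ℂ) :
    (volume : Measure ℂ).map f.toHomeomorph = volume :=
  f.measurePreserving.map_eq

/-- **Translation invariance of two-colour Poisson–Voronoi percolation**: for Lebesgue
intensities, every event has the same probability as its translate. [cite: Tassion2016, Remark 2] -/
theorem measure_preimage_pairImage_addRight {PB PW : Measure (PointConfig ℂ)}
    (hB : IsPoissonPointProcess (volume : Measure ℂ) PB)
    (hW : IsPoissonPointProcess (volume : Measure ℂ) PW) (v : ℂ) (A : Set (PointConfig ℂ × PointConfig ℂ)) :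
    (PB.prod PW) (pairImage (Homeomorph.addRight v) ⁻¹' A) = (PB.prod PW) A :=
  measure_preimage_pairImage hB hW _ (map_volume_addRight v) (map_volume_addRight v) A

/-- **Rotation / reflection invariance of two-colour Poisson–Voronoi percolation**: for Lebesgue
intensities, every event has the same probability as its image under a real-linear isometry of
`ℂ` applied to both colours. [cite: Tassion2016, Remark 2] -/
theorem measure_preimage_pairImage_linearIsometryEquiv {PB PW : Measure (PointConfig ℂ)}
    (hB : IsPoissonPointProcess (volume : Measure ℂ) PB)
    (hW : IsPoissonPointProcess (volume : Measure ℂ) PW) (f : ℂ ≃ₗᵢ[ℝ] ℂ)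
    (A : Set (PointConfig ℂ × PointConfig ℂ)) :
    (PB.prod PW) (pairImage f.toHomeomorph ⁻¹' A) = (PB.prod PW) A :=
  measure_preimage_pairImage hB hW _ (map_volume_linearIsometryEquiv f)
    (map_volume_linearIsometryEquiv f) A

end Plane

end Literature.Probability.Percolation
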